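import Summits.QuantumFields.YangMills.Theorems.MirrorModularBoostsSoftKernelBoostCovarianceTameOrderZero
import Summits.QuantumFields.YangMills.Theorems.MirrorModularBoostsSoftKernelBoostCovarianceSandwichOfOrderZero
import Summits.QuantumFields.YangMills.Theorems.MirrorModularBoostsSoftKernelBoostCovariancePlanarInvariantOfInputsWeak
import Summits.QuantumFields.YangMills.Theorems.SoftKernelBoostCovariance.Negative.TieLoadBearing
import HarnessLib

/-!
# `SoftKernelBoostCovariance` (B′) on the TAME SECTOR of Wilson schemes; the crux is equivalent to its restriction
# to the WILD SECTOR `|c_k| → ∞ ∧ ∀ᶠ k, β_k ≠ 0`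

Support file for the crux `MirrorModularBoosts.SoftKernelBoostCovariance` (stmt-QuantumFields-14999), line `Sketch`
(lead c9).  The crux is universally quantified over ALL sequential Wilson schemes `sch = (a_k, β_k, L_k, c_k, m_k)` of
the curvature species.  This file proves it on the TAME SECTOR — every scheme which, for infinitely many `k`, is at
zero coupling OR renormalises the curvature multiplicatively below a fixed bound — by RUNNING THE LINE: the landed
pointwise model-blind composition `stub_planarInvariantOfInputsWeak` (p143258: OS package + translations + hypercubic
+ eight frames + cone + kernel triple + `NPointRegular` + the sandwich pair ⇒ `PlanarInvariant`) is fed with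

* Step 0 on the tame sector — the landed `CurvatureDensities.nPointRegular_of_frequently_tame`;
* the sandwich PAIR on the tame sector with exponent `μ = 0` — order zero on `⁰𝒮` along tame schemes
  (`TameSector.stub_tameOrderZero`, degree `0` by E0) makes the signed multiple-reflection chains grow geometrically,
  so the landed engine of crux Σ gives the row (`TameSector.sandwich_of_orderZero`), for `S₁` AND for its `45°`
  pull-back (order zero is inherited by isometric pull-backs, `TameSector.orderZero_pullBack`).

Results:
* `orderZero_of_frequently_tame` — order zero in ALL degrees (degree `0` from the normalisation E0);
* `planarInvariant_of_frequently_tame` — B′ pointwise on the tame sector;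
* `softKernelBoostCovariance_tameSector` — the crux with the one extra tameness hypothesis (registered stub
  `stub_tameSector`);
* `wildSector_of_not_planarInvariant` — a tied coned 8-RP soft-kernel family that is NOT planar invariant forces
  `|c_k| → ∞` and `β_k ≠ 0` eventually;
* `softKernelBoostCovariance_iff_wildSector` — THE CRUX IS EQUIVALENT TO ITS RESTRICTION TO THE WILD SECTOR, the
  regime of the weak-coupling continuum limit with the physical renormalisation `c_k ≍ a_k⁻⁴` of `tr F²`, where its
  two residual stubs (`stub_regularHigh`, `stub_sandwichPair`) are the open Yang–Mills inputs (items
  stmt-QuantumFields-17721 / 18372).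

So every certified inhabitant of the hypotheses known to date (zero scheme, `β ≡ 0`, bounded `c_k`, strong coupling
with bounded renormalisation) is covered by a Lean proof of the conclusion, through the line's own machinery — a
non-vacuous end-to-end run of the 33 landed support files.

References: K. Osterwalder, E. Seiler, Ann. Phys. 110 (1978) §2; J. Glimm, A. Jaffe, Quantum Physics (1987) §6.1,
Thm 10.5.5; K. Osterwalder, R. Schrader, Comm. Math. Phys. 31 (1973) §4.1.
-/

noncomputable section

open scoped SchwartzMap BigOperators InnerProductSpace
open MeasureTheory Filter Topology
open Literature.MathematicalPhysics.QuantumFieldTheory Literature.MathematicalPhysics.QuantumLattice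
open Literature.MathematicalPhysics.AQFT
open Summit.QuantumFields.YangMills.Theorems.NPointIsotropy.Negative (E4 NPointRegular)
open Summit.QuantumFields.YangMills.Theorems.CurvatureBoostCovariance.Negative
  (OSPackage Translations Hypercubic EightFrameRP PlanarCone PlanarInvariant Tie Gaps W1)
open Summit.QuantumFields.YangMills.Theorems.SoftKernelBoostCovariance.Negative (SoftKernel softKernelBoostCovariance_iff)
open Summit.QuantumFields.YangMills.Theorems.CurvatureDensities (nPointRegular_of_frequently_tame)

namespace Summit.QuantumFields.YangMills.Theorems.SoftKernelBoostCovariance.Sketch.TameSector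

variable {G : Type} [Group G] [TopologicalSpace G] [IsTopologicalGroup G] [CompactSpace G]
  [MeasurableSpace G] [BorelSpace G]

/-! ## Order zero in all degrees on the tame sector -/

/-- **Degree zero is of order zero under E0**: `‖𝔖₀ F‖ = |F()| = ∫ |F|` (Lebesgue measure on the one-point space
`(ℝ⁴)⁰` is the Dirac mass). [folklore] -/
theorem norm_schwinger_zero_le (S₁ : SchwingerFamily E4) (h0 : S₁.toLabelled.IsNormalized) (A : ℝ)
    (F : 𝓢((Fin 0 → E4), ℂ)) : ‖S₁ 0 F‖ ≤ A ^ 0 * ∫ y, ‖F y‖ := by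
  have hvol : (volume : Measure (Fin 0 → E4)) = Measure.dirac default := by
    rw [MeasureTheory.volume_pi]
    exact Measure.pi_of_empty _ default
  have hS : S₁ 0 F = F default := (h0 (fun _ => ()) F).trans (congrArg F (Subsingleton.elim _ _))
  rw [pow_zero, one_mul, hvol, integral_dirac, hS]

/-- **Order zero in all degrees on the tame sector.**  For `W1 r sch S₁` (tie + E0) along a scheme frequently at zero
coupling or frequently of bounded multiplicative renormalisation: `‖𝔖ₘ F‖ ≤ Aᵐ ∫ |F|` for ALL `m` and all `F ∈ ⁰𝒮`. -/
theorem orderZero_of_frequently_tame (r : LatticeRep G) (sch : SpeciesScheme (YMSpecies G))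
    (S₁ : SchwingerFamily E4) (hW : W1 r sch S₁)
    (htame : ∃ B : ℝ, ∃ᶠ k in atTop, sch.β k = 0 ∨ |sch.c r.curvature k| ≤ B) :
    ∃ A : ℝ, 0 ≤ A ∧ ∀ (m : ℕ) (F : 𝓢((Fin m → E4), ℂ)), IsOffDiagonal F → ‖S₁ m F‖ ≤ A ^ m * ∫ y, ‖F y‖ := by
  obtain ⟨A, hA0, hA⟩ := stub_tameOrderZero G r sch S₁ hW htame
  refine ⟨A, hA0, fun m F hF => ?_⟩
  rcases Nat.eq_zero_or_pos m with rfl | hm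
  · exact norm_schwinger_zero_le S₁ hW.2.1.1 A F
  · exact hA m hm.ne' F hF

/-! ## The crux on the tame sector -/

/-- **B′ POINTWISE ON THE TAME SECTOR.**  Let `S₁` carry the curvature package `W1 r sch S₁`, reflection positivity
in the eight planar frames, the planar cone and the soft kernel triple, along a scheme which is frequently at zero
coupling or frequently of bounded multiplicative renormalisation.  Then `S₁` is invariant on `⁰𝒮` under every rotation
of the `(x₀,x₁)`-plane.  Proof: the landed composition `stub_planarInvariantOfInputsWeak` with Step 0 from
`nPointRegular_of_frequently_tame` and BOTH sandwich rows with `μ = 0` from order zero (`sandwich_of_orderZero`, for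
`S₁` and for its `45°` pull-back through `orderZero_pullBack`). -/
theorem planarInvariant_of_frequently_tame (r : LatticeRep G) (sch : SpeciesScheme (YMSpecies G))
    (S₁ : SchwingerFamily E4) (hW : W1 r sch S₁) (h8 : EightFrameRP S₁) (hC : PlanarCone S₁) (hK : SoftKernel S₁)
    (htame : ∃ B : ℝ, ∃ᶠ k in atTop, sch.β k = 0 ∨ |sch.c r.curvature k| ≤ B) : PlanarInvariant S₁ := by
  obtain ⟨_, hOS, htr, hhyp, -⟩ := id hW
  obtain ⟨A, hA0, hA⟩ := orderZero_of_frequently_tame r sch S₁ hW htame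
  have hreg : NPointRegular S₁ := nPointRegular_of_frequently_tame r sch S₁ hW.1 hW.2.1.1 htame
  refine stub_planarInvariantOfInputsWeak S₁ hOS htr hhyp h8 hC hK hreg (fun h => sandwich_of_orderZero S₁ hA0 hA h)
    fun h' => ?_
  obtain ⟨μ, C, -, hrow⟩ := sandwich_of_orderZero
    (fun n => (S₁ n).comp (linActMulti (planeRot (0 : Fin 3) (Real.pi / 4)))) hA0
    (orderZero_pullBack S₁ hA (planeRot (0 : Fin 3) (Real.pi / 4))) h'
  exact ⟨μ, C, hrow⟩

/-- **`SoftKernelBoostCovariance` ON THE TAME SECTOR** (registered stub `stub_tameSector` of crux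
stmt-QuantumFields-14999) — the crux with one extra hypothesis: for every compact `G`, `r`, `sch`, `S₁` with
`W1 r sch S₁`, the eight frames, the cone and the soft kernel, IF frequently along the scheme `β_k = 0` or `|c_k| ≤ B`,
then `S₁` is planar invariant on `⁰𝒮`. -/
theorem stub_tameSector :
    open Literature.MathematicalPhysics.QuantumLattice Literature.MathematicalPhysics.AQFT
      Literature.MathematicalPhysics.QuantumFieldTheory
      Summit.QuantumFields.YangMills.Theorems.CurvatureBoostCovariance.Negative
      Summit.QuantumFields.YangMills.Theorems.NPointIsotropy.Negative in
    ∀ (G : Type) [Group G] [TopologicalSpace G] [IsTopologicalGroup G] [CompactSpace G]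
      [MeasurableSpace G] [BorelSpace G],
      ∀ (r : LatticeRep G) (sch : SpeciesScheme (YMSpecies G)) (S₁ : SchwingerFamily E4),
        W1 r sch S₁ → EightFrameRP S₁ → PlanarCone S₁ →
        (∃ (K : E4 → ℝ) (C η : ℝ), 0 < η ∧ ContinuousOn K {x : E4 | x ≠ 0} ∧
          (∀ x : E4, x ≠ 0 → |K x| ≤ C * (1 + ‖x‖ ^ (η - 10))) ∧
          ∀ F : SchwartzMap (Fin 2 → E4) ℂ, IsOffDiagonal F →
            MeasureTheory.Integrable (fun x : Fin 2 → E4 => (K (x 0 - x 1) : ℂ) * F x) ∧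
              S₁ 2 F = ∫ x : Fin 2 → E4, (K (x 0 - x 1) : ℂ) * F x) →
        (∃ B : ℝ, ∃ᶠ k in Filter.atTop, sch.β k = 0 ∨ |sch.c r.curvature k| ≤ B) → PlanarInvariant S₁ :=
  fun _G _ _ _ _ _ _ r sch S₁ hW h8 hC hK htame => planarInvariant_of_frequently_tame r sch S₁ hW h8 hC hK htame

/-- **`SoftKernelBoostCovariance` on the tame sector** (alias of the registered stub, hypotheses in crux order). -/
theorem softKernelBoostCovariance_tameSector :
    ∀ (G : Type) [Group G] [TopologicalSpace G] [IsTopologicalGroup G] [CompactSpace G]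
      [MeasurableSpace G] [BorelSpace G], IsCompactSimpleLieGroup G →
      ∀ (r : LatticeRep G) (sch : SpeciesScheme (YMSpecies G)) (S₁ : SchwingerFamily E4),
        W1 r sch S₁ → EightFrameRP S₁ → PlanarCone S₁ → SoftKernel S₁ →
        (∃ B : ℝ, ∃ᶠ k in atTop, sch.β k = 0 ∨ |sch.c r.curvature k| ≤ B) → PlanarInvariant S₁ :=
  fun _G _ _ _ _ _ _ _ r sch S₁ hW h8 hC hK htame => planarInvariant_of_frequently_tame r sch S₁ hW h8 hC hK htame

/-! ## Where an obstruction must live: the crux is equivalent to its restriction to the wild sector -/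

/-- **A counterexample must be wild.**  If `W1 r sch S₁`, the eight frames, the cone and the soft kernel hold but `S₁`
is NOT planar invariant on `⁰𝒮`, then `|c_k| → ∞` along the whole scheme and `β_k ≠ 0` for all large `k`. -/
theorem wildSector_of_not_planarInvariant (r : LatticeRep G) (sch : SpeciesScheme (YMSpecies G))
    (S₁ : SchwingerFamily E4) (hW : W1 r sch S₁) (h8 : EightFrameRP S₁) (hC : PlanarCone S₁) (hK : SoftKernel S₁)
    (h : ¬ PlanarInvariant S₁) :
    Tendsto (fun k => |sch.c r.curvature k|) atTop atTop ∧ ∀ᶠ k in atTop, sch.β k ≠ 0 := by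
  constructor
  · by_contra hnot
    refine h (planarInvariant_of_frequently_tame r sch S₁ hW h8 hC hK ?_)
    rw [tendsto_atTop] at hnot
    obtain ⟨B, hB⟩ := not_forall.1 hnot
    exact ⟨B, (not_eventually.1 hB).mono fun _ hk => Or.inr (not_le.1 hk).le⟩
  · by_contra hnot
    exact h (planarInvariant_of_frequently_tame r sch S₁ hW h8 hC hK
      ⟨0, (not_eventually.1 hnot).mono fun _ hk => Or.inl (not_not.1 hk)⟩)

/-- **THE CRUX IS EQUIVALENT TO ITS RESTRICTION TO THE WILD SECTOR** `|c_k| → ∞ ∧ ∀ᶠ k, β_k ≠ 0` (the regime of the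
weak-coupling continuum limit with the physical renormalisation `c_k ≍ a_k⁻⁴` of `tr F²`): every other scheme is
covered by `softKernelBoostCovariance_tameSector`. -/
theorem softKernelBoostCovariance_iff_wildSector :
    Summit.QuantumFields.YangMills.Theses.MirrorModularBoosts.SoftKernelBoostCovariance ↔
      ∀ (G : Type) [Group G] [TopologicalSpace G] [IsTopologicalGroup G] [CompactSpace G],
        IsCompactSimpleLieGroup G →
        letI : MeasurableSpace G := borel G
        haveI : BorelSpace G := ⟨rfl⟩
        ∀ (r : LatticeRep G) (sch : SpeciesScheme (YMSpecies G)) (S₁ : SchwingerFamily E4),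
          W1 r sch S₁ → EightFrameRP S₁ → PlanarCone S₁ → SoftKernel S₁ →
          Tendsto (fun k => |sch.c r.curvature k|) atTop atTop → (∀ᶠ k in atTop, sch.β k ≠ 0) →
          PlanarInvariant S₁ := by
  rw [softKernelBoostCovariance_iff]
  constructor
  · intro h G _ _ _ _ hG r sch S₁ hW h8 hC hK _ _
    exact h G hG r sch S₁ hW h8 hC hK
  · intro h G _ _ _ _ hG
    letI : MeasurableSpace G := borel G
    haveI : BorelSpace G := ⟨rfl⟩
    intro r sch S₁ hW h8 hC hK
    by_contra hN
    obtain ⟨hc, hβ⟩ := wildSector_of_not_planarInvariant r sch S₁ hW h8 hC hK hN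
    exact hN (h G hG r sch S₁ hW h8 hC hK hc hβ)

end Summit.QuantumFields.YangMills.Theorems.SoftKernelBoostCovariance.Sketch.TameSector

end
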